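import Mathlib.Analysis.SpecialFunctions.Complex.Arg
import Mathlib.Analysis.SpecialFunctions.Complex.Log
import Mathlib.Analysis.SpecialFunctions.Trigonometric.Basic
import Mathlib.FieldTheory.IsAlgClosed.Basic
import Mathlib.Analysis.Complex.Polynomial.Basic
import Mathlib.Algebra.Polynomial.Roots
import HarnessLib

/-!
# Lee–Yang lattice laws: the finite trigonometric product of the characteristic function

For a probability law carried by the lattice points `ω(2d - n)`, `d ∈ {0, …, n}` — the law of
`ω Σ_{k ≤ n} σ_k` for `n` spins `σ_k = ±1`, masses `cᵢ > 0` indexed by configurations `i` with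
`dᵢ = #{k : σ_k = +}` — the two-sided Laplace transform is the exponential polynomial
`M(z) = Σᵢ cᵢ e^{zω(2dᵢ - n)} = e^{-zωn} P(e^{2zω})`, `P(t) = Σᵢ cᵢ t^{dᵢ}` (Lee–Yang's polynomial
in the fugacity `t = e^{2zω}`, Lee–Yang 1952, Appendix II). If `M` has only purely imaginary
zeros (the Lee–Yang property, e.g. `Literature.Probability.LatticeModels.HasLeeYangProperty` of
the law, proved for ferromagnetic Ising magnetization laws in `IsingLimitLaw`/`LeeYangProofs`),
then every root `ρ` of `P` lies on the unit circle (`ρ = e^{2zω}` with `M(z) = 0`), `ρ ≠ 1`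
(`P(1) = Σcᵢ = 1`), the roots are closed under conjugation (`P` is real), and factorising
`P = L∏(X - ρ)` gives, for real `ξ` and `x = ξω`,

  `M(√-1 ξ) = ∏_ρ g_ρ(x)`, `g_ρ(x) = (e^{ix} - ρ e^{-ix})/(1 - ρ)`,

with `g_{e^{iθ}}(x) g_{e^{-iθ}}(x) = sin(θ/2 - x)sin(θ/2 + x)/sin²(θ/2) = 1 - sin²x/sin²(θ/2)` and
`g_{-1}(x) = cos x`. Hence the **finite trigonometric product**

  `M(√-1 ξ) = cos(ξω)^a ∏_{θ ∈ S} (1 - sin²(ξω)/sin²(θ/2))`, `θ ∈ (0, π)`, `a + 2|S| = n`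

(`exists_trig_prod`) — an elementary, Hadamard-free form of Newman's product representation
(Newman 1975, Proposition 2) for lattice laws, each factor being an entire function of `ξ` with
real zeros only. This file is pure algebra over `ℂ` (roots of polynomials, `IsAlgClosed ℂ`); it is
used by `Literature/Barriers/CriticalPhenomena/RigorousRGSmallParameterHHWGibbs.lean` for the block
spin of the hierarchical Ising model (Hara–Hattori–Watanabe 2001, (2.9)).

## References

* T. D. Lee, C. N. Yang, Phys. Rev. 87 (1952) 410–419, Appendix II (zeros on the unit circle).
* C. M. Newman, Comm. Math. Phys. 41 (1975) 1–9, Proposition 2 (the product over the zeros).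
-/

noncomputable section

open scoped BigOperators
open Finset Complex Polynomial

namespace Literature.Probability.LatticeModels

namespace LeeYangTrig

/-! ### The per-root factor `g_ρ(x) = (e^{ix} - ρe^{-ix})/(1 - ρ)` -/

/-- `1 - e^{iθ} = -2i e^{iθ/2} sin(θ/2)`. [folklore] -/
theorem one_sub_exp_eq (θ : ℝ) :
    (1 : ℂ) - cexp (θ * I) = -2 * I * cexp (θ / 2 * I) * Complex.sin (θ / 2) := by
  have hv : cexp (θ * I) = cexp (θ / 2 * I) ^ 2 := by
    rw [sq, ← Complex.exp_add]; congr 1; ring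
  have hs2 : Complex.sin (θ / 2) = (cexp (-(θ / 2 * I)) - cexp (θ / 2 * I)) * I / 2 := by
    rw [Complex.sin]; ring_nf
  have e3 : cexp (-(θ / 2 * I)) = (cexp (θ / 2 * I))⁻¹ := by rw [Complex.exp_neg]
  rw [hs2, e3, hv]
  have hvne : cexp (θ / 2 * I) ≠ 0 := Complex.exp_ne_zero _
  field_simp
  ring_nf
  rw [Complex.I_sq]
  ring

/-- `g_{e^{iθ}}(x) = sin(θ/2 - x)/sin(θ/2)` when `sin(θ/2) ≠ 0`. [folklore] -/
theorem root_factor_eq_sin (θ x : ℝ) (hθ : Complex.sin (θ / 2) ≠ 0) :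
    (cexp (x * I) - cexp (θ * I) * cexp (-(x * I))) / (1 - cexp (θ * I)) =
      Complex.sin (θ / 2 - x) / Complex.sin (θ / 2) := by
  have hden : (1 : ℂ) - cexp (θ * I) ≠ 0 := by
    rw [one_sub_exp_eq]
    exact mul_ne_zero (mul_ne_zero (mul_ne_zero (by norm_num) Complex.I_ne_zero)
      (Complex.exp_ne_zero _)) hθ
  rw [div_eq_div_iff hden hθ]
  have hu : cexp (-(x * I)) = (cexp (x * I))⁻¹ := by rw [Complex.exp_neg]
  have hv : cexp (θ * I) = cexp (θ / 2 * I) ^ 2 := by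
    rw [sq, ← Complex.exp_add]; congr 1; ring
  have hs1 : Complex.sin (θ / 2 - x) =
      (cexp (-((θ / 2 - x) * I)) - cexp ((θ / 2 - x) * I)) * I / 2 := by
    rw [Complex.sin]; ring_nf
  have hs2 : Complex.sin (θ / 2) = (cexp (-(θ / 2 * I)) - cexp (θ / 2 * I)) * I / 2 := by
    rw [Complex.sin]; ring_nf
  have e1 : cexp (-((θ / 2 - x) * I)) = (cexp (θ / 2 * I))⁻¹ * cexp (x * I) := by
    rw [← Complex.exp_neg, ← Complex.exp_add]; congr 1; ring
  have e2 : cexp ((θ / 2 - x) * I) = cexp (θ / 2 * I) * (cexp (x * I))⁻¹ := by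
    rw [← Complex.exp_neg, ← Complex.exp_add]; congr 1; ring
  have e3 : cexp (-(θ / 2 * I)) = (cexp (θ / 2 * I))⁻¹ := by rw [Complex.exp_neg]
  rw [hs1, hs2, e1, e2, e3, hu, hv]
  have hune : cexp (x * I) ≠ 0 := Complex.exp_ne_zero _
  have hvne : cexp (θ / 2 * I) ≠ 0 := Complex.exp_ne_zero _
  field_simp

/-- `sin(A - B) sin(A + B) = sin²A - sin²B`. [folklore] -/
theorem sin_sub_mul_sin_add (A B : ℂ) :
    Complex.sin (A - B) * Complex.sin (A + B) = Complex.sin A ^ 2 - Complex.sin B ^ 2 := by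
  rw [Complex.sin_sub, Complex.sin_add]
  have hA := Complex.sin_sq_add_cos_sq A
  have hB := Complex.sin_sq_add_cos_sq B
  have : Complex.cos A ^ 2 = 1 - Complex.sin A ^ 2 := by linear_combination hA
  have hB' : Complex.cos B ^ 2 = 1 - Complex.sin B ^ 2 := by linear_combination hB
  calc (Complex.sin A * Complex.cos B - Complex.cos A * Complex.sin B) *
        (Complex.sin A * Complex.cos B + Complex.cos A * Complex.sin B)
      = Complex.sin A ^ 2 * Complex.cos B ^ 2 - Complex.cos A ^ 2 * Complex.sin B ^ 2 := by ring
    _ = Complex.sin A ^ 2 - Complex.sin B ^ 2 := by rw [this, hB']; ring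

/-- **The paired root factors**: for `ρ = e^{iθ}`, `ρ̄ = e^{-iθ}` with `sin(θ/2) ≠ 0`,
`g_ρ(x) g_{ρ̄}(x) = 1 - sin²x / sin²(θ/2)`. [folklore] -/
theorem root_factor_mul_conj (θ x : ℝ) (hθ : Real.sin (θ / 2) ≠ 0) :
    (cexp (x * I) - cexp (θ * I) * cexp (-(x * I))) / (1 - cexp (θ * I)) *
      ((cexp (x * I) - cexp ((-θ : ℝ) * I) * cexp (-(x * I))) / (1 - cexp ((-θ : ℝ) * I))) =
      ((1 - Real.sin x ^ 2 / Real.sin (θ / 2) ^ 2 : ℝ) : ℂ) := by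
  have hθc : Complex.sin (θ / 2) ≠ 0 := by
    rw [show (θ : ℂ) / 2 = ((θ / 2 : ℝ) : ℂ) by push_cast; ring, ← Complex.ofReal_sin]
    exact Complex.ofReal_ne_zero.2 hθ
  have hθc' : Complex.sin ((-θ : ℝ) / 2) ≠ 0 := by
    rw [show ((-θ : ℝ) : ℂ) / 2 = -((θ : ℂ) / 2) by push_cast; ring, Complex.sin_neg]
    exact neg_ne_zero.2 hθc
  rw [root_factor_eq_sin θ x hθc, root_factor_eq_sin (-θ) x hθc']
  have e1 : Complex.sin ((-θ : ℝ) / 2 - x) = -Complex.sin (θ / 2 + x) := by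
    rw [← Complex.sin_neg]; congr 1; push_cast; ring
  have e2 : Complex.sin ((-θ : ℝ) / 2) = -Complex.sin (θ / 2) := by
    rw [← Complex.sin_neg]; congr 1; push_cast; ring
  rw [e1, e2, neg_div_neg_eq, div_mul_div_comm, sin_sub_mul_sin_add]
  push_cast
  field_simp

/-- **The self-conjugate root factor**: `g_{-1}(x) = cos x`. [folklore] -/
theorem root_factor_neg_one (x : ℝ) :
    (cexp (x * I) - (-1) * cexp (-(x * I))) / (1 - (-1)) = ((Real.cos x : ℝ) : ℂ) := by
  rw [Complex.ofReal_cos, Complex.cos]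
  ring_nf

/-! ### The exponential polynomial of a lattice law and its algebraic polynomial -/

variable {ι : Type*} [Fintype ι]

/-- The Laplace transform `M(z) = Σᵢ cᵢ e^{zω(2dᵢ - n)}` of a law with masses `cᵢ` at the lattice
points `ω(2dᵢ - n)`, `dᵢ ∈ {0, …, n}` (the law of `ω Σ_k σ_k` for `n` spins `σ_k = ±1`).
[folklore] -/
def expPoly (c : ι → ℝ) (deg : ι → ℕ) (n : ℕ) (ω : ℝ) (z : ℂ) : ℂ :=
  ∑ i, (c i : ℂ) * cexp (z * (ω * (2 * (deg i : ℝ) - n)))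

/-- The algebraic polynomial `P(t) = Σᵢ cᵢ t^{dᵢ}` with `M(z) = e^{-zωn} P(e^{2zω})`
(Lee–Yang's polynomial in the fugacity). [cite: LeeYang1952, Appendix II] -/
def genPoly (c : ι → ℝ) (deg : ι → ℕ) : ℂ[X] :=
  ∑ i, Polynomial.C (c i : ℂ) * Polynomial.X ^ (deg i)

variable (c : ι → ℝ) (deg : ι → ℕ) (n : ℕ) (ω : ℝ)

/-- `P(t) = Σᵢ cᵢ t^{dᵢ}`. [folklore] -/
theorem eval_genPoly (t : ℂ) : (genPoly c deg).eval t = ∑ i, (c i : ℂ) * t ^ (deg i) := by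
  simp [genPoly, Polynomial.eval_finsetSum]

/-- `M(z) = e^{-zωn} P(e^{2zω})`. [cite: LeeYang1952, Appendix II] -/
theorem expPoly_eq (z : ℂ) :
    expPoly c deg n ω z = cexp (-(z * ω * n)) * (genPoly c deg).eval (cexp (2 * z * ω)) := by
  rw [eval_genPoly, expPoly, Finset.mul_sum]
  refine Finset.sum_congr rfl fun i _ => ?_
  rw [← Complex.exp_nat_mul, show cexp (-(z * ω * n)) * ((c i : ℂ) * cexp (↑(deg i) * (2 * z * ω)))
      = (c i : ℂ) * cexp (-(z * ω * n) + ↑(deg i) * (2 * z * ω)) by rw [Complex.exp_add]; ring]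
  congr 2
  push_cast
  ring

/-- `deg P ≤ n`. [folklore] -/
theorem natDegree_genPoly_le (hdeg : ∀ i, deg i ≤ n) : (genPoly c deg).natDegree ≤ n := by
  unfold genPoly
  refine Polynomial.natDegree_sum_le_of_forall_le _ _ fun i _ => ?_
  exact (Polynomial.natDegree_C_mul_X_pow_le _ _).trans (hdeg i)

/-- The coefficients of `P`: `coeff_k P = Σ_{dᵢ = k} cᵢ`. [folklore] -/
theorem coeff_genPoly (k : ℕ) :
    (genPoly c deg).coeff k = ∑ i, if deg i = k then (c i : ℂ) else 0 := by
  simp only [genPoly, Polynomial.finsetSum_coeff, Polynomial.coeff_C_mul_X_pow]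
  refine Finset.sum_congr rfl fun i _ => ?_
  by_cases h : deg i = k
  · simp [h]
  · simp only [h, if_false, ite_eq_right_iff]
    intro h'; exact absurd h'.symm h

/-- With positive masses and the top degree attained, `deg P = n` exactly. [folklore] -/
theorem natDegree_genPoly (hc : ∀ i, 0 < c i) (hdeg : ∀ i, deg i ≤ n) {i₁ : ι} (hi₁ : deg i₁ = n) :
    (genPoly c deg).natDegree = n ∧ (genPoly c deg).coeff n ≠ 0 := by
  have hcoeff : (genPoly c deg).coeff n ≠ 0 := by
    rw [coeff_genPoly]
    have hre : (∑ i, if deg i = n then (c i : ℂ) else 0).re = ∑ i, if deg i = n then c i else 0 := by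
      rw [Complex.re_sum]
      refine Finset.sum_congr rfl fun i _ => ?_
      split_ifs <;> simp
    intro h0
    have hpos : 0 < ∑ i, if deg i = n then c i else 0 := by
      refine lt_of_lt_of_le (by simpa [hi₁] using hc i₁) (Finset.single_le_sum (f := fun i =>
        if deg i = n then c i else 0) (fun i _ => ?_) (Finset.mem_univ i₁))
      split_ifs
      · exact (hc i).le
      · exact le_rfl
    rw [← hre, h0, Complex.zero_re] at hpos
    exact lt_irrefl _ hpos
  refine ⟨le_antisymm (natDegree_genPoly_le c deg n hdeg) ?_, hcoeff⟩
  exact Polynomial.le_natDegree_of_ne_zero hcoeff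

/-- `P` has real coefficients: `P̄ = P`. [folklore] -/
theorem map_conj_genPoly : (genPoly c deg).map (starRingEnd ℂ) = genPoly c deg := by
  simp [genPoly, Polynomial.map_sum]

/-! ### The roots of `P` under the Lee–Yang hypothesis -/

section Roots

variable {c deg n ω}
variable (hc : ∀ i, 0 < c i) (hdeg : ∀ i, deg i ≤ n) {i₀ i₁ : ι} (hi₀ : deg i₀ = 0)
  (hi₁ : deg i₁ = n) (hc1 : ∑ i, c i = 1) (hω : ω ≠ 0)
  (hLY : ∀ z : ℂ, expPoly c deg n ω z = 0 → z.re = 0)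

include hc hdeg hi₁ in
/-- `P` has `n` roots counted with multiplicity (ℂ is algebraically closed, `deg P = n`).
[folklore] -/
theorem card_roots_genPoly : Multiset.card (genPoly c deg).roots = n :=
  (Polynomial.splits_iff_card_roots.1 (IsAlgClosed.splits _)).trans
    (natDegree_genPoly c deg n hc hdeg hi₁).1

include hc hdeg hi₁ in
/-- `P = L ∏_ρ (X - ρ)`, `L = coeff_n P`. [folklore] -/
theorem genPoly_eq_prod_roots :
    genPoly c deg = Polynomial.C ((genPoly c deg).coeff n) *
      ((genPoly c deg).roots.map fun a => Polynomial.X - Polynomial.C a).prod := by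
  have h := natDegree_genPoly c deg n hc hdeg hi₁
  have := Polynomial.C_leadingCoeff_mul_prod_multiset_X_sub_C (p := genPoly c deg)
    ((card_roots_genPoly hc hdeg hi₁).trans h.1.symm)
  rw [Polynomial.leadingCoeff, h.1] at this
  exact this.symm

include hc hdeg hi₁ in
/-- `P(t) = L ∏_ρ (t - ρ)`. [folklore] -/
theorem eval_genPoly_eq_prod (t : ℂ) :
    (genPoly c deg).eval t = (genPoly c deg).coeff n *
      ((genPoly c deg).roots.map fun a => t - a).prod := by
  conv_lhs => rw [genPoly_eq_prod_roots hc hdeg hi₁]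
  rw [Polynomial.eval_mul, Polynomial.eval_C, Polynomial.eval_multiset_prod, Multiset.map_map]
  congr 2
  refine Multiset.map_congr rfl fun a _ => ?_
  simp

include hc hdeg hi₁ in
/-- `P ≠ 0`. [folklore] -/
theorem genPoly_ne_zero : genPoly c deg ≠ 0 := fun h => by
  have := (natDegree_genPoly c deg n hc hdeg hi₁).2
  rw [h, Polynomial.coeff_zero] at this
  exact this rfl

include hc hi₀ in
/-- `P(0) ≠ 0` (the lowest lattice point carries mass), so `0` is not a root. [folklore] -/
theorem eval_zero_genPoly_ne_zero : (genPoly c deg).eval 0 ≠ 0 := by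
  rw [eval_genPoly]
  have hre : (∑ i, (c i : ℂ) * (0 : ℂ) ^ deg i).re = ∑ i, if deg i = 0 then c i else 0 := by
    rw [Complex.re_sum]
    refine Finset.sum_congr rfl fun i _ => ?_
    by_cases h : deg i = 0 <;> simp [h]
  intro h0
  have hpos : 0 < ∑ i, if deg i = 0 then c i else 0 := by
    refine lt_of_lt_of_le (by simpa [hi₀] using hc i₀) (Finset.single_le_sum (f := fun i =>
      if deg i = 0 then c i else 0) (fun i _ => ?_) (Finset.mem_univ i₀))
    split_ifs
    · exact (hc i).le
    · exact le_rfl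
  rw [← hre, h0, Complex.zero_re] at hpos
  exact lt_irrefl _ hpos

include hc1 in
/-- `P(1) = Σ cᵢ = 1`. [folklore] -/
theorem eval_one_genPoly : (genPoly c deg).eval 1 = 1 := by
  rw [eval_genPoly]
  simp only [one_pow, mul_one]
  rw [← Complex.ofReal_sum, hc1, Complex.ofReal_one]

include hc hdeg hi₀ hi₁ hc1 hω hLY in
/-- **The roots lie on the unit circle** (and are `≠ 1`): if `P(ρ) = 0` then `ρ = e^{2zω}` with
`M(z) = 0`, so `Re z = 0` by the Lee–Yang hypothesis. [cite: LeeYang1952, Appendix II] -/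
theorem norm_eq_one_of_mem_roots {ρ : ℂ} (hρ : ρ ∈ (genPoly c deg).roots) :
    ‖ρ‖ = 1 ∧ ρ ≠ 1 := by
  rw [Polynomial.mem_roots (genPoly_ne_zero hc hdeg hi₁), Polynomial.IsRoot.def] at hρ
  have hρ0 : ρ ≠ 0 := by
    rintro rfl
    exact eval_zero_genPoly_ne_zero hc hi₀ hρ
  refine ⟨?_, ?_⟩
  · set z : ℂ := Complex.log ρ / (2 * ω) with hz
    have h2 : 2 * z * ω = Complex.log ρ := by
      rw [hz]
      have : (ω : ℂ) ≠ 0 := Complex.ofReal_ne_zero.2 hω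
      field_simp
    have hM : expPoly c deg n ω z = 0 := by
      rw [expPoly_eq, h2, Complex.exp_log hρ0, hρ, mul_zero]
    have hre := hLY z hM
    have : (Complex.log ρ).re = 0 := by
      rw [← h2, show (2 : ℂ) * z * ω = z * ((2 * ω : ℝ) : ℂ) by push_cast; ring,
        Complex.re_mul_ofReal, hre, zero_mul]
    rw [Complex.log_re] at this
    rcases Real.log_eq_zero.1 this with h | h | h
    · exact absurd (norm_eq_zero.1 h) hρ0
    · exact h
    · linarith [norm_nonneg ρ]
  · rintro rfl
    rw [eval_one_genPoly hc1] at hρ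
    exact one_ne_zero hρ

include hc hdeg hi₁ hc1 in
/-- **The product over the roots**: for real `ξ`, with `x = ξω` and
`g_ρ(x) = (e^{ix} - ρe^{-ix})/(1 - ρ)`, `M(√-1 ξ) = ∏_ρ g_ρ(x)` — from `P = L∏(X - ρ)`,
`M(√-1 ξ) = e^{-inx} P(e^{2ix})` and the normalisation `1 = M(0) = L ∏(1 - ρ)`.
[cite: LeeYang1952, Appendix II] -/
theorem expPoly_mul_I_eq_prod (ξ : ℝ) :
    expPoly c deg n ω (ξ * I) = ((genPoly c deg).roots.map fun ρ =>
      (cexp ((ξ * ω : ℝ) * I) - ρ * cexp (-((ξ * ω : ℝ) * I))) / (1 - ρ)).prod := by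
  set R := (genPoly c deg).roots with hR
  set L := (genPoly c deg).coeff n with hL
  have hcard : Multiset.card R = n := card_roots_genPoly hc hdeg hi₁
  -- normalisation: `1 = L ∏ (1 - ρ)`
  have hnorm : L * (R.map fun ρ => 1 - ρ).prod = 1 := by
    have := eval_genPoly_eq_prod hc hdeg hi₁ (1 : ℂ)
    rw [eval_one_genPoly hc1] at this
    exact this.symm
  have hLeq : L = ((R.map fun ρ => 1 - ρ).prod)⁻¹ :=
    eq_inv_of_mul_eq_one_left hnorm
  -- the main computation
  set u : ℂ := cexp ((ξ * ω : ℝ) * I) with hu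
  have hu2 : cexp (2 * (ξ * I) * ω) = u ^ 2 := by
    rw [hu, sq, ← Complex.exp_add]; congr 1; push_cast; ring
  have hun : cexp (-(ξ * I * ω * n)) = (cexp (-((ξ * ω : ℝ) * I))) ^ n := by
    rw [← Complex.exp_nat_mul]; congr 1; push_cast; ring
  rw [expPoly_eq, eval_genPoly_eq_prod hc hdeg hi₁, hu2, hun, ← hL, ← hR, hLeq]
  have hfac : ∀ ρ : ℂ, (u - ρ * cexp (-((ξ * ω : ℝ) * I))) / (1 - ρ) =
      cexp (-((ξ * ω : ℝ) * I)) * (u ^ 2 - ρ) * (1 - ρ)⁻¹ := by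
    intro ρ
    rw [div_eq_mul_inv]
    congr 1
    rw [hu, sq, Complex.exp_neg]
    field_simp
  simp_rw [hfac, Multiset.prod_map_mul, Multiset.prod_map_inv, Multiset.map_const',
    Multiset.prod_replicate, hcard]
  ring

include hc hdeg hi₀ hi₁ hc1 hω hLY in
/-- A real root on the unit circle other than `1` is `-1`. [folklore] -/
theorem eq_neg_one_of_mem_roots {ρ : ℂ} (hρ : ρ ∈ (genPoly c deg).roots) (him : ρ.im = 0) :
    ρ = -1 := by
  obtain ⟨hnorm, hne⟩ := norm_eq_one_of_mem_roots hc hdeg hi₀ hi₁ hc1 hω hLY hρ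
  have hsq : ρ.re ^ 2 = 1 := by
    have := Complex.sq_norm ρ
    rw [Complex.normSq_apply, hnorm, him] at this
    nlinarith
  have hre : ρ.re = 1 ∨ ρ.re = -1 := mul_self_eq_one_iff.1 (by rw [← sq]; exact hsq)
  rcases hre with h | h
  · exact absurd (Complex.ext (by simp [h]) (by simp [him])) hne
  · exact Complex.ext (by simp [h]) (by simp [him])

include hc hdeg hi₁ in
/-- The root multiset is closed under complex conjugation (`P` is real). [folklore] -/
theorem map_conj_roots : (genPoly c deg).roots.map (starRingEnd ℂ) = (genPoly c deg).roots := by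
  rw [Polynomial.roots_map_of_injective_of_card_eq_natDegree (starRingEnd ℂ).injective
    ((card_roots_genPoly hc hdeg hi₁).trans (natDegree_genPoly c deg n hc hdeg hi₁).1.symm),
    map_conj_genPoly]

/-- A root in the open upper half plane has argument in `(0, π)`. [folklore] -/
theorem arg_mem_Ioo_of_im_pos {ρ : ℂ} (h : 0 < ρ.im) : 0 < Complex.arg ρ ∧ Complex.arg ρ < Real.pi := by
  refine ⟨lt_of_le_of_ne (Complex.arg_nonneg_iff.2 h.le) fun h0 => ?_,
    lt_of_le_of_ne (Complex.arg_le_pi ρ) fun hπ => ?_⟩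
  · exact absurd (Complex.arg_eq_zero_iff.1 h0.symm).2 h.ne'
  · exact absurd (Complex.arg_eq_pi_iff.1 hπ).2 h.ne'

include hc hdeg hi₀ hi₁ hc1 hω hLY in
/-- **The finite trigonometric product of a Lee–Yang lattice law.** If the masses `cᵢ > 0` sit at
the lattice points `ω(2dᵢ - n)` with both ends `d = 0`, `d = n` charged, `Σcᵢ = 1`, and the Laplace
transform `M` has only purely imaginary zeros, then for real `ξ`
`M(√-1 ξ) = cos(ξω)^a ∏_{θ ∈ S} (1 - sin²(ξω)/sin²(θ/2))` for some `a ∈ ℕ` and a finite family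
`S` of angles in `(0, π)` with `a + 2|S| = n`: the roots `e^{±iθ}`, `-1` of Lee–Yang's polynomial
on the unit circle, paired with their conjugates. [cite: LeeYang1952, Appendix II] -/
theorem exists_trig_prod :
    ∃ (a : ℕ) (S : Multiset ℝ), (∀ θ ∈ S, 0 < θ ∧ θ < Real.pi) ∧ a + 2 * Multiset.card S = n ∧
      ∀ ξ : ℝ, expPoly c deg n ω (ξ * I) =
        ((Real.cos (ξ * ω) ^ a *
          (S.map fun θ => 1 - Real.sin (ξ * ω) ^ 2 / Real.sin (θ / 2) ^ 2).prod : ℝ) : ℂ) := by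
  classical
  set R := (genPoly c deg).roots with hR
  set Rp := R.filter fun ρ => 0 < ρ.im with hRp
  set Rm := R.filter fun ρ => ρ.im < 0 with hRm
  set R0 := R.filter fun ρ => ρ.im = 0 with hR0
  -- the decomposition of the roots
  have hsplit : R = Rp + (Rm + R0) := by
    rw [hRp, hRm, hR0, Multiset.filter_add_filter]
    have h1 : Multiset.filter (fun ρ : ℂ => ρ.im < 0 ∧ ρ.im = 0) R = 0 :=
      Multiset.filter_eq_nil.2 fun ρ _ h => by linarith [h.1, h.2.le]
    rw [h1, add_zero]
    have h2 : Multiset.filter (fun ρ : ℂ => ρ.im < 0 ∨ ρ.im = 0) R =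
        Multiset.filter (fun ρ : ℂ => ¬ 0 < ρ.im) R :=
      Multiset.filter_congr fun ρ _ => by constructor <;> intro h <;> [exact not_lt.2 (by rcases h with h | h <;> linarith); exact (not_lt.1 h).lt_or_eq]
    rw [h2, Multiset.filter_add_not]
  have hRm_eq : Rm = Rp.map (starRingEnd ℂ) := by
    rw [hRm, hRp]
    conv_lhs => rw [hR, ← map_conj_roots hc hdeg hi₁, ← hR]
    rw [Multiset.filter_map]
    congr 1
    refine Multiset.filter_congr fun ρ _ => ?_
    simp only [Function.comp_apply, Complex.conj_im, neg_lt_zero]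
  have hR0_eq : R0 = Multiset.replicate (Multiset.card R0) (-1 : ℂ) :=
    Multiset.eq_replicate_card.2 fun ρ hρ => by
      rw [hR0, Multiset.mem_filter] at hρ
      exact eq_neg_one_of_mem_roots hc hdeg hi₀ hi₁ hc1 hω hLY hρ.1 hρ.2
  refine ⟨Multiset.card R0, Rp.map Complex.arg, fun θ hθ => ?_, ?_, fun ξ => ?_⟩
  · obtain ⟨ρ, hρ, rfl⟩ := Multiset.mem_map.1 hθ
    rw [hRp, Multiset.mem_filter] at hρ
    exact arg_mem_Ioo_of_im_pos hρ.2
  · have hcard : Multiset.card R = n := card_roots_genPoly hc hdeg hi₁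
    rw [hsplit, Multiset.card_add, Multiset.card_add, hRm_eq, Multiset.card_map] at hcard
    rw [Multiset.card_map]
    omega
  · rw [expPoly_mul_I_eq_prod hc hdeg hi₁ hc1, ← hR, hsplit, Multiset.map_add, Multiset.map_add,
      Multiset.prod_add, Multiset.prod_add, hRm_eq, hR0_eq, Multiset.map_replicate,
      Multiset.prod_replicate, Multiset.map_map, ← mul_assoc, ← Multiset.prod_map_mul,
      root_factor_neg_one, Multiset.card_replicate]
    -- the paired factors
    have hpair : ∀ ρ ∈ Rp, (cexp ((ξ * ω : ℝ) * I) - ρ * cexp (-((ξ * ω : ℝ) * I))) / (1 - ρ) *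
        ((fun ρ => (cexp ((ξ * ω : ℝ) * I) - ρ * cexp (-((ξ * ω : ℝ) * I))) / (1 - ρ)) ∘
          (starRingEnd ℂ)) ρ =
        ((1 - Real.sin (ξ * ω) ^ 2 / Real.sin (Complex.arg ρ / 2) ^ 2 : ℝ) : ℂ) := by
      intro ρ hρ
      rw [hRp, Multiset.mem_filter] at hρ
      obtain ⟨hθ0, hθπ⟩ := arg_mem_Ioo_of_im_pos hρ.2
      have hnorm : ‖ρ‖ = 1 := (norm_eq_one_of_mem_roots hc hdeg hi₀ hi₁ hc1 hω hLY hρ.1).1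
      set θ : ℝ := Complex.arg ρ with hθ
      have hρeq : ρ = cexp ((θ : ℝ) * I) := by
        have := Complex.norm_mul_exp_arg_mul_I ρ
        rw [hnorm, Complex.ofReal_one, one_mul, ← hθ] at this
        exact this.symm
      have hconj : (starRingEnd ℂ) ρ = cexp (((-θ : ℝ) : ℂ) * I) := by
        rw [hρeq, ← Complex.exp_conj]
        congr 1
        simp [Complex.conj_ofReal]
      have hsin : Real.sin (θ / 2) ≠ 0 :=
        (Real.sin_pos_of_pos_of_lt_pi (by linarith) (by linarith)).ne'
      simp only [Function.comp_apply]
      rw [hconj, hρeq]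
      exact root_factor_mul_conj θ (ξ * ω) hsin
    rw [Multiset.map_congr rfl hpair]
    have hcast : (Multiset.map (fun ρ => ((1 - Real.sin (ξ * ω) ^ 2 /
        Real.sin (Complex.arg ρ / 2) ^ 2 : ℝ) : ℂ)) Rp).prod =
        (((Multiset.map (fun θ => 1 - Real.sin (ξ * ω) ^ 2 / Real.sin (θ / 2) ^ 2)
          (Multiset.map Complex.arg Rp)).prod : ℝ) : ℂ) := by
      rw [Multiset.map_map, ← Complex.ofRealHom_eq_coe, map_multiset_prod, Multiset.map_map]
      rfl
    rw [hcast]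
    push_cast
    ring

end Roots

end LeeYangTrig

end Literature.Probability.LatticeModels

end
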